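import Literature.NumberTheory.Rogawski1990.TestFunctions
import Literature.NumberTheory.Automorphic.UnitaryGroupPlaceInclusion
import Literature.NumberTheory.Automorphic.LocalCentralizerUnimodularOfAdelic
import HarnessLib

/-!
# A restricted pure tensor determines its local factors up to placewise scalars: `eval` under ONE-PLACE SURGERY, and the
# proportionality of the factors of two pure tensors with the same `eval` (Borel–Jacquet 1979 §4.1; Flath 1979 §2–§3;
# Platonov–Rapinchuk 1994 §5.1)

Topic `NumberTheory/Rogawski1990` (companion of ★ `TestFunctions`: `UnitaryGroup.PureTensor L N H`, `PureTensor.eval`);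
namespace `Literature.NumberTheory.Automorphic.UnitaryGroup.PureTensor`.  THEOREMS ONLY (no definition, no instance, no notation,
no named fact, no `sorry`).  Cell `hodgecm-mathlib`, programme R90-TF, section S9 «InnerForm-13.3.6 (c)», deal (tw-close-LIT) of
R90-IF-plan (g2) 2026-09-05T02:43:46Z (ED. 5 groundwork for the closed «transport-twist» `tw` of FILE B's record-datum producer:
a Hecke twist of a transfer `f = T′.eval` must be read on the factors of `T′`, and two factorisations of one function must give the
same twist — this file is the factor-rigidity that makes that well defined).  `--supports stmt-HodgeConjecture-24833`.

## What is formalised (`L` CM, `H ∈ M_N(L)`, `G = U(H)`, `g_v := (cmDatum L N H).toLocal v g`, `g_∞ := archPart g`,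
## `ι_v := inclPlaceAdelic L⁺ L c̄ N H v` the coordinate embedding of ★ `UnitaryGroupPlaceInclusion`)
* §1 ONE-PLACE MODIFICATIONS EXIST (stated on the CM datum's own carriers `(cmDatum L N H).Adelic ∕ .Local v`, so that consumers never
  meet the generic-datum types): `exists_modification_at v y` — an `e ∈ U(H)(𝔸)` with `e_v = y`, `e_w = 1` (`w ≠ v`), `e_∞ = 1` (witness
  `ι_v (localPiEquiv⁻¹ y)`); `exists_modification_arch a` — an `e` with all `e_w = 1` and `e_∞ = a` (witness `archToAdelic a`).
* §2 `eval` UNDER A MODIFICATION SUPPORTED AT ONE PLACE, in DIVISION-FREE CROSS FORM valid at EVERY place (on the bad set `T.S` by the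
  finite product, off it by `loc_eq_indicator`): **`eval_mul_mul_loc`** — for `e` with `e_w = 1` (`w ≠ v`) and `e_∞ = 1`:
  `T.eval (g · e) · T.loc v g_v = T.eval g · T.loc v (g · e)_v`; **`eval_mul_mul_arch`** — for `e` with all `e_w = 1`:
  `T.eval (g · e) · T.arch g_∞ = T.eval g · T.arch (g · e)_∞`; the PIVOTS of a non-vanishing value: `loc_toLocal_ne_zero_of_eval_ne_zero`
  (`T.eval g ≠ 0 → T.loc v g_v ≠ 0`, every `v`), `arch_archPart_ne_zero_of_eval_ne_zero`.
* §3 PROPORTIONALITY («a pure tensor determines its factors up to scalars», [Flath1979, §2]): for `T₁.eval = T₂.eval` and a point `g⁰`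
  with `T₁.eval g⁰ ≠ 0`: **`loc_mul_loc_eq_of_eval_eq`** — `T₂.loc v x · T₁.loc v g⁰_v = T₁.loc v x · T₂.loc v g⁰_v` for every `v` and
  `x` (so `T₂.loc v = c_v • T₁.loc v`, `c_v = T₂.loc v g⁰_v / T₁.loc v g⁰_v`, both pivots `≠ 0`), and **`arch_mul_arch_eq_of_eval_eq`** —
  the archimedean twin; packaged: `exists_loc_eq_smul_of_eval_eq` (`∃ c ≠ 0, T₂.loc v = c • T₁.loc v`), `exists_arch_eq_smul_of_eval_eq`.
* §4 POINTS WITH PRESCRIBED COMPONENTS and the ZERO CRITERION: `exists_adelic_of_components` (`g_v = x_v` on `S`, `g_w = 1` off `S`, `g_∞ = a`),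
  `exists_eval_ne_zero_of_factors`, **`forall_eval_eq_zero_iff`** — `(∀ g, T.eval g = 0) ↔ (∀ a, T.arch a = 0) ∨ ∃ v ∈ T.S, ∀ x, T.loc v x = 0`.

## Mathlib / tree search
Tree (★, by name): `Rogawski1990/TestFunctions` (`PureTensor`, `eval`, `eval_eq_of_forall_mem`, `eval_eq_zero_of_not_mem`, `loc_apply_of_mem`,
`loc_eq_indicator`), `UnitaryGroupPlaceInclusion` (`inclPlaceAdelic`, `evalPlace_finPart_inclPlaceAdelic`, `evalPlace_inclPlace_of_ne`,
`archPart_inclPlaceAdelic`, `finPart_inclPlaceAdelic`), `UnitaryGroupAdelicProduct` (`archPart`, `finPart`, `archPart_archToAdelic`,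
`finPart_archToAdelic`), `LocalCentralizerUnimodularOfAdelic` (`cmDatum_toLocal_eq_localPiEquiv`), `PureTensorCentralValues`
(`eval_eq_eval_of_forall_loc_eq` — the converse direction).  `lean search 'exists_modification|eval_mul_mul_loc|loc_mul_loc_eq_of_eval'`: nothing.

## References
* [BorelJacquet1979] A. Borel, H. Jacquet, *Automorphic forms and automorphic representations*, PSPM 33.1 (1979), §4.1 (restricted tensor products).
* [Flath1979] D. Flath, *Decomposition of representations into tensor products*, PSPM 33.1 (1979), §2–§3.
* [PlatonovRapinchuk1994] V. Platonov, A. Rapinchuk, *Algebraic Groups and Number Theory* (1994), §5.1 (coordinate embeddings of `G_𝔸`).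
-/

set_option autoImplicit false

noncomputable section

open NumberField IsDedekindDomain
open scoped Classical

namespace Literature.NumberTheory.Automorphic.UnitaryGroup.PureTensor

variable {L : Type} [Field L] [NumberField L] [IsCMField L] {N : ℕ} {H : Matrix (Fin N) (Fin N) L}

/-! ## §1 One-place modifications of adelic points exist -/

/-- **A MODIFICATION SUPPORTED AT THE FINITE PLACE `v`**: for every `y ∈ U(H)(L⁺_v)` there is `e ∈ U(H)(𝔸_{L⁺})` with `e_v = y`, `e_w = 1` for
`w ≠ v` and `e_∞ = 1` — the coordinate embedding `ι_v (localPiEquiv⁻¹ y)` of ★ `UnitaryGroupPlaceInclusion`, read on the CM datum through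
★ `cmDatum_toLocal_eq_localPiEquiv`. [cite: PlatonovRapinchuk1994, §5.1] [cite: BorelJacquet1979, §4.1] -/
theorem exists_modification_at (v : HeightOneSpectrum (𝓞 ↥(maximalRealSubfield L))) (y : (cmDatum L N H).Local v) :
    ∃ e : (cmDatum L N H).Adelic, (cmDatum L N H).toLocal v e = y ∧
      (∀ w : HeightOneSpectrum (𝓞 ↥(maximalRealSubfield L)), w ≠ v → (cmDatum L N H).toLocal w e = 1) ∧
      archPart (↥(maximalRealSubfield L)) L (IsCMField.complexConj L) N H e = 1 := by
  refine ⟨inclPlaceAdelic (↥(maximalRealSubfield L)) L (IsCMField.complexConj L) N H v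
      ((localPiEquiv L (IsCMField.complexConj L) N H v).symm y), ?_, fun w hw => ?_, ?_⟩
  · rw [cmDatum_toLocal_eq_localPiEquiv, finPart_inclPlaceAdelic, evalPlace_inclPlace, ContinuousMulEquiv.apply_symm_apply]
  · rw [cmDatum_toLocal_eq_localPiEquiv, finPart_inclPlaceAdelic, evalPlace_inclPlace_of_ne _ _ _ _ _ hw, map_one]
    exact rfl
  · exact archPart_inclPlaceAdelic _ _ _ _ _ v _

/-- **A MODIFICATION AT INFINITY**: for every `a ∈ U(H)(L⁺ ⊗ ℝ)` there is `e ∈ U(H)(𝔸_{L⁺})` with all finite components `e_w = 1` and `e_∞ = a`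
(the archimedean embedding ★ `archToAdelic`, ★ `finPart_archToAdelic`, ★ `archPart_archToAdelic`). [cite: BorelJacquet1979, §4.1] -/
theorem exists_modification_arch (a : UnitaryGroup.arch (↥(maximalRealSubfield L)) L (IsCMField.complexConj L) N H) :
    ∃ e : (cmDatum L N H).Adelic, (∀ w : HeightOneSpectrum (𝓞 ↥(maximalRealSubfield L)), (cmDatum L N H).toLocal w e = 1) ∧
      archPart (↥(maximalRealSubfield L)) L (IsCMField.complexConj L) N H e = a := by
  refine ⟨archToAdelic (↥(maximalRealSubfield L)) L (IsCMField.complexConj L) N H a, fun w => ?_, ?_⟩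
  · rw [cmDatum_toLocal_eq_localPiEquiv, finPart_archToAdelic, map_one, map_one]
    exact rfl
  · exact archPart_archToAdelic _ _ _ _ _ a

/-! ## §2 `eval` under a modification supported at one place (cross form), and the pivots of a non-vanishing value -/

/-- **`eval` UNDER A MODIFICATION SUPPORTED AT A FINITE PLACE, CROSS FORM**: if `e_w = 1` for `w ≠ v` and `e_∞ = 1`, then
`T.eval (g · e) · T.loc v g_v = T.eval g · T.loc v (g · e)_v` at EVERY place `v` — on the bad set the two sides are the same finite
product with the `v`-factor read at `(g · e)_v` resp. `g_v` and then cross-multiplied; off the bad set `T.loc v` is the indicator of the level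
`T.K v` (★ `loc_eq_indicator`) and both sides carry the product of the two membership indicators. [cite: BorelJacquet1979, §4.1] [cite: Flath1979, §2] -/
theorem eval_mul_mul_loc (T : PureTensor L N H) (g e : (cmDatum L N H).Adelic) (v : HeightOneSpectrum (𝓞 ↥(maximalRealSubfield L)))
    (he : ∀ w : HeightOneSpectrum (𝓞 ↥(maximalRealSubfield L)), w ≠ v → (cmDatum L N H).toLocal w e = 1)
    (ha : archPart (↥(maximalRealSubfield L)) L (IsCMField.complexConj L) N H e = 1) :
    T.eval (g * e) * T.loc v ((cmDatum L N H).toLocal v g) = T.eval g * T.loc v ((cmDatum L N H).toLocal v (g * e)) := by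
  have hne : ∀ w, w ≠ v → (cmDatum L N H).toLocal w (g * e) = (cmDatum L N H).toLocal w g := fun w hw => by
    rw [map_mul, he w hw, mul_one]
  have harch : archPart (↥(maximalRealSubfield L)) L (IsCMField.complexConj L) N H (g * e) =
      archPart (↥(maximalRealSubfield L)) L (IsCMField.complexConj L) N H g := by
    have hm : archPart (↥(maximalRealSubfield L)) L (IsCMField.complexConj L) N H (g * e) =
        archPart (↥(maximalRealSubfield L)) L (IsCMField.complexConj L) N H g *
          archPart (↥(maximalRealSubfield L)) L (IsCMField.complexConj L) N H e := map_mul _ _ _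
    rw [hm, ha, mul_one]
  by_cases hv : v ∈ T.S
  · -- on the bad set: the unramified condition is the same for `g` and `g · e`, the products differ only in the `v`-factor
    have hcond : (∀ w ∉ T.S, (cmDatum L N H).toLocal w (g * e) ∈ T.K w) ↔ (∀ w ∉ T.S, (cmDatum L N H).toLocal w g ∈ T.K w) := by
      refine forall₂_congr fun w hw => ?_
      rw [hne w (fun h => hw (h ▸ hv))]
    by_cases hg : ∀ w ∉ T.S, (cmDatum L N H).toLocal w g ∈ T.K w
    · rw [eval_eq_of_forall_mem T (g * e) (hcond.2 hg), eval_eq_of_forall_mem T g hg, harch,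
        ← Finset.mul_prod_erase T.S (fun w => T.loc w ((cmDatum L N H).toLocal w (g * e))) hv,
        ← Finset.mul_prod_erase T.S (fun w => T.loc w ((cmDatum L N H).toLocal w g)) hv]
      have hprod : ∏ w ∈ T.S.erase v, T.loc w ((cmDatum L N H).toLocal w (g * e)) = ∏ w ∈ T.S.erase v, T.loc w ((cmDatum L N H).toLocal w g) :=
        Finset.prod_congr rfl fun w hw => by rw [hne w (Finset.ne_of_mem_erase hw)]
      rw [hprod]
      ring
    · have hg' : ¬ ∀ w ∉ T.S, (cmDatum L N H).toLocal w (g * e) ∈ T.K w := fun h => hg (hcond.1 h)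
      obtain ⟨w, hw, hwK⟩ := not_forall₂.1 hg
      obtain ⟨w', hw', hwK'⟩ := not_forall₂.1 hg'
      rw [eval_eq_zero_of_not_mem T g hw hwK, eval_eq_zero_of_not_mem T (g * e) hw' hwK', zero_mul, zero_mul]
  · -- off the bad set: `T.loc v` is the indicator of `T.K v`
    have hK : ∀ x : (cmDatum L N H).Local v, T.loc v x = if x ∈ T.K v then 1 else 0 := fun x => by
      rw [T.loc_eq_indicator v hv]; rfl
    by_cases hrest : ∀ w ∉ T.S, w ≠ v → (cmDatum L N H).toLocal w g ∈ T.K w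
    · by_cases h1 : (cmDatum L N H).toLocal v g ∈ T.K v
      · by_cases h2 : (cmDatum L N H).toLocal v (g * e) ∈ T.K v
        · have hg : ∀ w ∉ T.S, (cmDatum L N H).toLocal w g ∈ T.K w := fun w hw => by
            by_cases hwv : w = v
            · subst hwv; exact h1
            · exact hrest w hw hwv
          have hge : ∀ w ∉ T.S, (cmDatum L N H).toLocal w (g * e) ∈ T.K w := fun w hw => by
            by_cases hwv : w = v
            · subst hwv; exact h2
            · rw [hne w hwv]; exact hrest w hw hwv
          rw [eval_eq_of_forall_mem T (g * e) hge, eval_eq_of_forall_mem T g hg, harch, hK, hK, if_pos h1, if_pos h2,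
            Finset.prod_congr rfl fun w hw => by rw [hne w (fun h => hv (h ▸ hw))]]
        · rw [hK ((cmDatum L N H).toLocal v (g * e)), if_neg h2, mul_zero, eval_eq_zero_of_not_mem T (g * e) hv h2, zero_mul]
      · rw [hK ((cmDatum L N H).toLocal v g), if_neg h1, mul_zero, eval_eq_zero_of_not_mem T g hv h1, zero_mul]
    · obtain ⟨w, hw, hwv, hwK⟩ : ∃ w, w ∉ T.S ∧ w ≠ v ∧ (cmDatum L N H).toLocal w g ∉ T.K w := by
        simpa only [not_forall, exists_prop] using hrest
      rw [eval_eq_zero_of_not_mem T g hw hwK, eval_eq_zero_of_not_mem T (g * e) hw (by rw [hne w hwv]; exact hwK),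
        zero_mul, zero_mul]

/-- **`eval` UNDER A MODIFICATION AT INFINITY, CROSS FORM**: if all finite components of `e` are trivial, then
`T.eval (g · e) · T.arch g_∞ = T.eval g · T.arch (g · e)_∞`. [cite: BorelJacquet1979, §4.1] -/
theorem eval_mul_mul_arch (T : PureTensor L N H) (g e : (cmDatum L N H).Adelic)
    (he : ∀ w : HeightOneSpectrum (𝓞 ↥(maximalRealSubfield L)), (cmDatum L N H).toLocal w e = 1) :
    T.eval (g * e) * T.arch (archPart (↥(maximalRealSubfield L)) L (IsCMField.complexConj L) N H g) =
      T.eval g * T.arch (archPart (↥(maximalRealSubfield L)) L (IsCMField.complexConj L) N H (g * e)) := by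
  have hloc : ∀ w, (cmDatum L N H).toLocal w (g * e) = (cmDatum L N H).toLocal w g := fun w => by
    rw [map_mul, he w, mul_one]
  by_cases hg : ∀ w ∉ T.S, (cmDatum L N H).toLocal w g ∈ T.K w
  · have hge : ∀ w ∉ T.S, (cmDatum L N H).toLocal w (g * e) ∈ T.K w := fun w hw => by rw [hloc w]; exact hg w hw
    rw [eval_eq_of_forall_mem T (g * e) hge, eval_eq_of_forall_mem T g hg, Finset.prod_congr rfl fun w _ => by rw [hloc w]]
    ring
  · obtain ⟨w, hw, hwK⟩ := not_forall₂.1 hg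
    rw [eval_eq_zero_of_not_mem T g hw hwK, eval_eq_zero_of_not_mem T (g * e) hw (by rw [hloc w]; exact hwK), zero_mul, zero_mul]

/-- **PIVOTS, finite places**: if `T.eval g ≠ 0` then `T.loc v g_v ≠ 0` at EVERY `v` (on the bad set a factor of the non-zero product;
off it `g_v ∈ T.K v` and the indicator is `1`). [cite: Flath1979, §2] -/
theorem loc_toLocal_ne_zero_of_eval_ne_zero (T : PureTensor L N H) {g : (cmDatum L N H).Adelic} (h : T.eval g ≠ 0)
    (v : HeightOneSpectrum (𝓞 ↥(maximalRealSubfield L))) : T.loc v ((cmDatum L N H).toLocal v g) ≠ 0 := by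
  have hg : ∀ w ∉ T.S, (cmDatum L N H).toLocal w g ∈ T.K w := by
    by_contra hc
    obtain ⟨w, hw, hwK⟩ := not_forall₂.1 hc
    exact h (eval_eq_zero_of_not_mem T g hw hwK)
  by_cases hv : v ∈ T.S
  · rw [eval_eq_of_forall_mem T g hg] at h
    exact fun h0 => h (by rw [Finset.prod_eq_zero hv h0, mul_zero])
  · rw [loc_apply_of_mem T hv (hg v hv)]
    exact one_ne_zero

/-- **PIVOT at infinity**: if `T.eval g ≠ 0` then `T.arch g_∞ ≠ 0`. [cite: Flath1979, §2] -/
theorem arch_archPart_ne_zero_of_eval_ne_zero (T : PureTensor L N H) {g : (cmDatum L N H).Adelic} (h : T.eval g ≠ 0) :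
    T.arch (archPart (↥(maximalRealSubfield L)) L (IsCMField.complexConj L) N H g) ≠ 0 := by
  have hg : ∀ w ∉ T.S, (cmDatum L N H).toLocal w g ∈ T.K w := by
    by_contra hc
    obtain ⟨w, hw, hwK⟩ := not_forall₂.1 hc
    exact h (eval_eq_zero_of_not_mem T g hw hwK)
  rw [eval_eq_of_forall_mem T g hg] at h
  exact left_ne_zero_of_mul h

/-! ## §3 Proportionality of the factors of two pure tensors with the same `eval` -/

/-- **A PURE TENSOR DETERMINES ITS FINITE FACTORS UP TO SCALARS**: if `T₁.eval = T₂.eval` and `T₁.eval g⁰ ≠ 0`, then at EVERY finite place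
`v` and every `x ∈ U(H)(L⁺_v)`, `T₂.loc v x · T₁.loc v g⁰_v = T₁.loc v x · T₂.loc v g⁰_v` — i.e. `T₂.loc v = c_v • T₁.loc v` with
`c_v = T₂.loc v g⁰_v / T₁.loc v g⁰_v` (both pivots non-zero by `loc_toLocal_ne_zero_of_eval_ne_zero`).  Proof: modify `g⁰` at `v` so that the
new `v`-component is `x` (§1) and read both `eval`s through `eval_mul_mul_loc`. [cite: Flath1979, §2–§3] [cite: BorelJacquet1979, §4.1] -/
theorem loc_mul_loc_eq_of_eval_eq (T₁ T₂ : PureTensor L N H) (h : T₁.eval = T₂.eval) {g₀ : (cmDatum L N H).Adelic}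
    (h0 : T₁.eval g₀ ≠ 0) (v : HeightOneSpectrum (𝓞 ↥(maximalRealSubfield L))) (x : (cmDatum L N H).Local v) :
    T₂.loc v x * T₁.loc v ((cmDatum L N H).toLocal v g₀) = T₁.loc v x * T₂.loc v ((cmDatum L N H).toLocal v g₀) := by
  -- the modification `e` with `(g⁰ · e)_v = x`
  obtain ⟨e, hev, hew, hea⟩ := exists_modification_at (L := L) (N := N) (H := H) v (((cmDatum L N H).toLocal v g₀)⁻¹ * x)
  have hx : (cmDatum L N H).toLocal v (g₀ * e) = x := by rw [map_mul, hev, mul_inv_cancel_left]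
  have h1 := eval_mul_mul_loc T₁ g₀ e v hew hea
  have h2 := eval_mul_mul_loc T₂ g₀ e v hew hea
  rw [hx] at h1 h2
  rw [← h] at h2
  -- `E(g⁰e) · a₁ = E(g⁰) · T₁.loc x` and `E(g⁰e) · a₂ = E(g⁰) · T₂.loc x` with `E(g⁰) ≠ 0`: cross-multiply and cancel
  have key : T₁.eval g₀ * (T₂.loc v x * T₁.loc v ((cmDatum L N H).toLocal v g₀)) =
      T₁.eval g₀ * (T₁.loc v x * T₂.loc v ((cmDatum L N H).toLocal v g₀)) := by
    calc T₁.eval g₀ * (T₂.loc v x * T₁.loc v ((cmDatum L N H).toLocal v g₀))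
        = (T₁.eval g₀ * T₂.loc v x) * T₁.loc v ((cmDatum L N H).toLocal v g₀) := by ring
      _ = (T₁.eval (g₀ * e) * T₂.loc v ((cmDatum L N H).toLocal v g₀)) * T₁.loc v ((cmDatum L N H).toLocal v g₀) := by rw [h2]
      _ = (T₁.eval (g₀ * e) * T₁.loc v ((cmDatum L N H).toLocal v g₀)) * T₂.loc v ((cmDatum L N H).toLocal v g₀) := by ring
      _ = (T₁.eval g₀ * T₁.loc v x) * T₂.loc v ((cmDatum L N H).toLocal v g₀) := by rw [h1]
      _ = T₁.eval g₀ * (T₁.loc v x * T₂.loc v ((cmDatum L N H).toLocal v g₀)) := by ring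
  exact mul_left_cancel₀ h0 key

/-- **… AND ITS ARCHIMEDEAN FACTOR UP TO A SCALAR**: under the same hypotheses, for every `y ∈ U(H)(L⁺ ⊗ ℝ)`,
`T₂.arch y · T₁.arch g⁰_∞ = T₁.arch y · T₂.arch g⁰_∞`. [cite: Flath1979, §2–§3] [cite: BorelJacquet1979, §4.1] -/
theorem arch_mul_arch_eq_of_eval_eq (T₁ T₂ : PureTensor L N H) (h : T₁.eval = T₂.eval) {g₀ : (cmDatum L N H).Adelic}
    (h0 : T₁.eval g₀ ≠ 0) (y : UnitaryGroup.arch (↥(maximalRealSubfield L)) L (IsCMField.complexConj L) N H) :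
    T₂.arch y * T₁.arch (archPart (↥(maximalRealSubfield L)) L (IsCMField.complexConj L) N H g₀) =
      T₁.arch y * T₂.arch (archPart (↥(maximalRealSubfield L)) L (IsCMField.complexConj L) N H g₀) := by
  obtain ⟨e, hew, hea⟩ := exists_modification_arch (L := L) (N := N) (H := H)
    ((archPart (↥(maximalRealSubfield L)) L (IsCMField.complexConj L) N H g₀)⁻¹ * y)
  have hy : archPart (↥(maximalRealSubfield L)) L (IsCMField.complexConj L) N H (g₀ * e) = y := by
    have hm : archPart (↥(maximalRealSubfield L)) L (IsCMField.complexConj L) N H (g₀ * e) =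
        archPart (↥(maximalRealSubfield L)) L (IsCMField.complexConj L) N H g₀ *
          archPart (↥(maximalRealSubfield L)) L (IsCMField.complexConj L) N H e := map_mul _ _ _
    rw [hm, hea, mul_inv_cancel_left]
  have h1 := eval_mul_mul_arch T₁ g₀ e hew
  have h2 := eval_mul_mul_arch T₂ g₀ e hew
  rw [hy] at h1 h2
  rw [← h] at h2
  have key : T₁.eval g₀ * (T₂.arch y * T₁.arch (archPart (↥(maximalRealSubfield L)) L (IsCMField.complexConj L) N H g₀)) =
      T₁.eval g₀ * (T₁.arch y * T₂.arch (archPart (↥(maximalRealSubfield L)) L (IsCMField.complexConj L) N H g₀)) := by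
    calc T₁.eval g₀ * (T₂.arch y * T₁.arch (archPart (↥(maximalRealSubfield L)) L (IsCMField.complexConj L) N H g₀))
        = (T₁.eval g₀ * T₂.arch y) * T₁.arch (archPart (↥(maximalRealSubfield L)) L (IsCMField.complexConj L) N H g₀) := by ring
      _ = (T₁.eval (g₀ * e) * T₂.arch (archPart (↥(maximalRealSubfield L)) L (IsCMField.complexConj L) N H g₀)) *
            T₁.arch (archPart (↥(maximalRealSubfield L)) L (IsCMField.complexConj L) N H g₀) := by rw [h2]
      _ = (T₁.eval (g₀ * e) * T₁.arch (archPart (↥(maximalRealSubfield L)) L (IsCMField.complexConj L) N H g₀)) *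
            T₂.arch (archPart (↥(maximalRealSubfield L)) L (IsCMField.complexConj L) N H g₀) := by ring
      _ = (T₁.eval g₀ * T₁.arch y) * T₂.arch (archPart (↥(maximalRealSubfield L)) L (IsCMField.complexConj L) N H g₀) := by rw [h1]
      _ = T₁.eval g₀ * (T₁.arch y * T₂.arch (archPart (↥(maximalRealSubfield L)) L (IsCMField.complexConj L) N H g₀)) := by ring
  exact mul_left_cancel₀ h0 key

/-- **PROPORTIONALITY CONSTANT, packaged**: under the same hypotheses there is `c ≠ 0` with `T₂.loc v = c • T₁.loc v` (namely
`c = T₂.loc v g⁰_v / T₁.loc v g⁰_v`). [cite: Flath1979, §2–§3] -/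
theorem exists_loc_eq_smul_of_eval_eq (T₁ T₂ : PureTensor L N H) (h : T₁.eval = T₂.eval) {g₀ : (cmDatum L N H).Adelic}
    (h0 : T₁.eval g₀ ≠ 0) (v : HeightOneSpectrum (𝓞 ↥(maximalRealSubfield L))) :
    ∃ c : ℂ, c ≠ 0 ∧ T₂.loc v = c • T₁.loc v := by
  have hp1 : T₁.loc v ((cmDatum L N H).toLocal v g₀) ≠ 0 := loc_toLocal_ne_zero_of_eval_ne_zero T₁ h0 v
  have hp2 : T₂.loc v ((cmDatum L N H).toLocal v g₀) ≠ 0 := loc_toLocal_ne_zero_of_eval_ne_zero T₂ (h ▸ h0) v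
  refine ⟨T₂.loc v ((cmDatum L N H).toLocal v g₀) / T₁.loc v ((cmDatum L N H).toLocal v g₀), div_ne_zero hp2 hp1, funext fun x => ?_⟩
  rw [Pi.smul_apply, smul_eq_mul, div_mul_eq_mul_div, eq_div_iff hp1, mul_comm (T₂.loc v _) (T₁.loc v x)]
  exact loc_mul_loc_eq_of_eval_eq T₁ T₂ h h0 v x

/-- The archimedean twin: `T₂.arch = c_∞ • T₁.arch` with `c_∞ = T₂.arch g⁰_∞ / T₁.arch g⁰_∞ ≠ 0`. [cite: Flath1979, §2–§3] -/
theorem exists_arch_eq_smul_of_eval_eq (T₁ T₂ : PureTensor L N H) (h : T₁.eval = T₂.eval) {g₀ : (cmDatum L N H).Adelic}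
    (h0 : T₁.eval g₀ ≠ 0) : ∃ c : ℂ, c ≠ 0 ∧ T₂.arch = c • T₁.arch := by
  have hp1 : T₁.arch (archPart (↥(maximalRealSubfield L)) L (IsCMField.complexConj L) N H g₀) ≠ 0 :=
    arch_archPart_ne_zero_of_eval_ne_zero T₁ h0
  have hp2 : T₂.arch (archPart (↥(maximalRealSubfield L)) L (IsCMField.complexConj L) N H g₀) ≠ 0 :=
    arch_archPart_ne_zero_of_eval_ne_zero T₂ (h ▸ h0)
  refine ⟨T₂.arch (archPart (↥(maximalRealSubfield L)) L (IsCMField.complexConj L) N H g₀) /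
      T₁.arch (archPart (↥(maximalRealSubfield L)) L (IsCMField.complexConj L) N H g₀), div_ne_zero hp2 hp1, funext fun y => ?_⟩
  rw [Pi.smul_apply, smul_eq_mul, div_mul_eq_mul_div, eq_div_iff hp1, mul_comm (T₂.arch _) (T₁.arch y)]
  exact arch_mul_arch_eq_of_eval_eq T₁ T₂ h h0 y

/-! ## §4 Points with prescribed components, and the zero criterion for `eval` -/

/-- **ADELIC POINTS WITH PRESCRIBED COMPONENTS**: for a finite set `S` of finite places, local elements `x_v` and an archimedean `a`, there is
`g ∈ U(H)(𝔸_{L⁺})` with `g_v = x_v` on `S`, `g_w = 1` off `S`, `g_∞ = a` (product of the one-place modifications of §1).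
[cite: PlatonovRapinchuk1994, §5.1] [cite: BorelJacquet1979, §4.1] -/
theorem exists_adelic_of_components (S : Finset (HeightOneSpectrum (𝓞 ↥(maximalRealSubfield L))))
    (x : ∀ v : HeightOneSpectrum (𝓞 ↥(maximalRealSubfield L)), (cmDatum L N H).Local v)
    (a : UnitaryGroup.arch (↥(maximalRealSubfield L)) L (IsCMField.complexConj L) N H) :
    ∃ g : (cmDatum L N H).Adelic, (∀ v ∈ S, (cmDatum L N H).toLocal v g = x v) ∧
      (∀ w : HeightOneSpectrum (𝓞 ↥(maximalRealSubfield L)), w ∉ S → (cmDatum L N H).toLocal w g = 1) ∧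
      archPart (↥(maximalRealSubfield L)) L (IsCMField.complexConj L) N H g = a := by
  induction S using Finset.induction_on with
  | empty =>
    obtain ⟨e, hew, hea⟩ := exists_modification_arch (L := L) (N := N) (H := H) a
    exact ⟨e, fun v hv => absurd hv (Finset.notMem_empty v), fun w _ => hew w, hea⟩
  | insert v s hvs ih =>
    obtain ⟨g, hgS, hgoff, hga⟩ := ih
    obtain ⟨e, hev, hew, hea⟩ := exists_modification_at (L := L) (N := N) (H := H) v (((cmDatum L N H).toLocal v g)⁻¹ * x v)
    refine ⟨g * e, fun w hw => ?_, fun w hw => ?_, ?_⟩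
    · rcases Finset.mem_insert.1 hw with rfl | hws
      · rw [map_mul, hev, mul_inv_cancel_left]
      · rw [map_mul, hew w (fun h => hvs (h ▸ hws)), mul_one, hgS w hws]
    · rw [Finset.mem_insert, not_or] at hw
      rw [map_mul, hew w hw.1, mul_one, hgoff w hw.2]
    · have hm : archPart (↥(maximalRealSubfield L)) L (IsCMField.complexConj L) N H (g * e) =
          archPart (↥(maximalRealSubfield L)) L (IsCMField.complexConj L) N H g *
            archPart (↥(maximalRealSubfield L)) L (IsCMField.complexConj L) N H e := map_mul _ _ _
      rw [hm, hea, mul_one, hga]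

/-- **NON-VANISHING FACTORS GIVE A NON-VANISHING VALUE**: if `T.arch a ≠ 0` and `T.loc v (x_v) ≠ 0` for every `v ∈ T.S`, then `T.eval g ≠ 0` at
the point `g` with these components (and `1` off `T.S`). [cite: Flath1979, §2] [cite: BorelJacquet1979, §4.1] -/
theorem exists_eval_ne_zero_of_factors (T : PureTensor L N H) {a : UnitaryGroup.arch (↥(maximalRealSubfield L)) L (IsCMField.complexConj L) N H}
    (ha : T.arch a ≠ 0) {x : ∀ v : HeightOneSpectrum (𝓞 ↥(maximalRealSubfield L)), (cmDatum L N H).Local v}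
    (hx : ∀ v ∈ T.S, T.loc v (x v) ≠ 0) : ∃ g : (cmDatum L N H).Adelic, T.eval g ≠ 0 := by
  obtain ⟨g, hgS, hgoff, hga⟩ := exists_adelic_of_components (L := L) (N := N) (H := H) T.S x a
  refine ⟨g, ?_⟩
  have hcond : ∀ w ∉ T.S, (cmDatum L N H).toLocal w g ∈ T.K w := fun w hw => by
    rw [hgoff w hw]; exact Subgroup.one_mem _
  rw [eval_eq_of_forall_mem T g hcond, hga]
  refine mul_ne_zero ha (Finset.prod_ne_zero_iff.2 fun v hv => ?_)
  rw [hgS v hv]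
  exact hx v hv

/-- **ZERO CRITERION**: `T.eval` vanishes identically iff its archimedean factor vanishes identically or some local factor on the bad set
vanishes identically. [cite: Flath1979, §2] [cite: BorelJacquet1979, §4.1] -/
theorem forall_eval_eq_zero_iff (T : PureTensor L N H) :
    (∀ g : (cmDatum L N H).Adelic, T.eval g = 0) ↔
      (∀ a, T.arch a = 0) ∨ ∃ v ∈ T.S, ∀ x : (cmDatum L N H).Local v, T.loc v x = 0 := by
  constructor
  · intro h
    by_contra hc
    rw [not_or, not_forall, not_exists] at hc
    obtain ⟨⟨a, ha⟩, hS⟩ := hc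
    have hx : ∀ v, ∃ x : (cmDatum L N H).Local v, v ∈ T.S → T.loc v x ≠ 0 := fun v => by
      by_cases hv : v ∈ T.S
      · have hv' := hS v
        rw [not_and, not_forall] at hv'
        obtain ⟨x, hx⟩ := hv' hv
        exact ⟨x, fun _ => hx⟩
      · exact ⟨1, fun h' => absurd h' hv⟩
    choose x hx using hx
    obtain ⟨g, hg⟩ := exists_eval_ne_zero_of_factors T ha (x := x) fun v hv => hx v hv
    exact hg (h g)
  · rintro (harch | ⟨v, hv, hloc⟩) g
    · by_cases hg : ∀ w ∉ T.S, (cmDatum L N H).toLocal w g ∈ T.K w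
      · rw [eval_eq_of_forall_mem T g hg, harch, zero_mul]
      · obtain ⟨w, hw, hwK⟩ := not_forall₂.1 hg
        exact eval_eq_zero_of_not_mem T g hw hwK
    · by_cases hg : ∀ w ∉ T.S, (cmDatum L N H).toLocal w g ∈ T.K w
      · rw [eval_eq_of_forall_mem T g hg, Finset.prod_eq_zero hv (hloc _), mul_zero]
      · obtain ⟨w, hw, hwK⟩ := not_forall₂.1 hg
        exact eval_eq_zero_of_not_mem T g hw hwK

end Literature.NumberTheory.Automorphic.UnitaryGroup.PureTensor

end
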